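/-
Copyright (c) 2026 the pub-hodgecm-mathlib formalisation cell (harness21).  Prover seat hodgecm-mathlib-R90-IF-p02 (g2), programme R90-TF, section S9 «InnerForm-13.3.6 (c)»,
deal (S5-rows) offer (a) «`hliftE` from «`liftsTo` is functional» and the level rigidity `htP`» (R90-IF-plan (g2), R90 bus 2026-09-04T23:26:53Z; census `CENSUS-S5rows.p02.md` row `hliftE`).
-/
import Summits.HodgeConjecture.HodgeConjecture.Theorems.R90S9InnerFormSec146Levels   -- ★ p862556 (R90-IF-p04 (g2)): the level datum — `Level`, `Evp`, `gradePacket`, `gradePacketH` (+ read-backs `gradePacketH_of_exists ∕ _of_not_exists`)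
import HarnessLib

/-!
# R90-TF · S9 «InnerForm-13.3.6 (c)» — the (MN-cm) binder `hliftE` «a graded packet `Π` carries `ρ`'s grade iff `Π = Π(ρ)`» from TWO LAWS: «`Π(ρ)` is unique»
# (`liftsTo` functional) and «the grade at a level determines the packet» (`htP`), X-generic (Rogawski 1990 §13.3 Thm. 13.3.2 p. 201, Thm. 13.3.5 p. 202; §13.7 p. 206; §14.6 p. 242)

Cell `hodgecm-mathlib`, crux H413 (`stmt-HodgeConjecture-24833`, lane `--supports … --as helper`), route of record `HCCMUnconditional` (no route verbs; count-neutral).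
Programme R90-TF (HUMAN RULING «R90-TF SLAB — MAX PUSH»; brief `director/R90-BRIEF.v2.md` 1f40d54518340a35), section S9 = InnerForm-13.3.6 (c) (base `R90-IF`); seat R90-IF-p02 (g2);
deal (S5-rows) of R90-IF-plan (g2) 23:26:53Z, offer (a) of the census `R90/R90-IF-p02/g2/CENSUS-S5rows.p02.md` c599bb407bf0acd1 (row `hliftE`).  ONE THEOREM (+ its two halves);
no `def`, no instance, no notation, no named-fact hypothesis, no `sorry`; imports ★ `Theorems` only (FILE B ED. 4 imports THIS file).
HONEST LABEL: HC_CM is proved only modulo the 7 printed citations (2 remaining named inputs: hLiu418 = stmt-HodgeConjecture-24832, h413 = stmt-HodgeConjecture-24833) — until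
rung 0 closes.  This file proves NOTHING printed: it is the 15-line DICTIONARY that turns the binder `hliftE` of ★ (MN-cm) `hmn_gammaSph_ofLevelPins` (★ `R90S9HmnAtLevelDatum`;
= ★ (δ6c) `definiteAeRigidity_payLine` :281–:283) into two laws with NAMED payers: «`liftsTo` is FUNCTIONAL» (`hfun : liftsTo ρ P → liftsTo ρ Q → P = Q` — at the record
`X.G := gOfRecord …` this is S5-C2's hypothesis-free ★-grade `R90.S5.LiftsToOfRecord.packet_eq`, Thm. 13.3.2∕13.3.5: `Π(ρ)` unique) and the level RIGIDITY `htP` (two packets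
graded alike at a level are equal — B ED. 4 row 29 `sock_S9_tP_cm`, Thm. 13.3.5 «`Π_v = Π′_v` a.a. `v` ⇒ `Π = Π′`»), over ★ p04's `gradePacketH l ρ := gradePacket l Π(ρ)` (the
chosen packet `ρ` lifts to, `none` if none; ★ Levels :271–:282).

## The print [Rogawski1990, §13.3 Thm. 13.3.2 p. 201, Thm. 13.3.5 p. 202; §13.7 p. 206; §14.6 p. 242 l. 10–15]
«… a collection `t_{S′} = {t_v}_{v∉S′}` … can be regarded as an e.v.p. on either `G′` or `G`» — `ψ_G(t_{S′}(ρ)) := t_{S′}(Π(ρ))`, and «the map `ψ_G` is injective on e.v.p.'s» (§13.7):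
a packet `Π` graded `e` at `S′` carries `ρ`'s grade `e` iff `Π(ρ)` exists and is graded `e`, iff (rigidity at `S′`) `Π = Π(ρ)`.

## Contents (namespace `Summit.HodgeConjecture.HodgeConjecture.R90.S9.InnerFormSec146`, X-generic over ★ `DatumInputs`)
* `gradePacketH_eq_of_liftsTo` — (→): `liftsTo ρ P → gradePacketH l ρ = gradePacket l P`, from `hfun` alone.
* `liftsTo_of_gradePacketH_eq_some` — (←): `gradePacket l P = some e → gradePacketH l ρ = some e → liftsTo ρ P`, from `htP` alone.
* **`hliftE_of_functional_of_tP`** — the binder `hliftE` VERBATIM: `gradePacket l P = some e → (X.G.liftsTo ρ P ↔ gradePacketH l ρ = some e)`.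
B's term (row `hliftE`): `hliftE := InnerFormSec146.hliftE_of_functional_of_tP _ _ _ L ι H T hT μ νG Ξ₀ 𝔩 (X_cm …) (fun _ _ _ h h' => R90.S5.LiftsToOfRecord.packet_eq h h') (sock_S9_tP_cm …)`.

## References
[Rogawski1990] J. D. Rogawski, *Automorphic Representations of Unitary Groups in Three Variables*, Ann. of Math. Stud. 123 (1990): §13.3 Thm. 13.3.2 p. 201, Thm. 13.3.5 p. 202;
§13.7 p. 206; §14.6 p. 242 l. 10–15.
-/

set_option autoImplicit false
set_option linter.dupNamespace false  -- the mandated namespace repeats the summit's segment (`HodgeConjecture.HodgeConjecture`)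

noncomputable section

open NumberField IsDedekindDomain MeasureTheory
open scoped Matrix MatrixGroups Classical
open Literature.NumberTheory Literature.NumberTheory.Automorphic Literature.NumberTheory.Automorphic.UnitaryGroup
open Literature.NumberTheory.Rogawski1990
open Summit.HodgeConjecture.HodgeConjecture.Cruxes.H413
open Summit.HodgeConjecture.HodgeConjecture.Cruxes.H413.F0P3GlobalPacket Summit.HodgeConjecture.HodgeConjecture.Cruxes.H413.F0P3LocalPacketKit

namespace Summit.HodgeConjecture.HodgeConjecture.R90.S9.InnerFormSec146

section LiftGrade

variable (TG' TG TH : Type) (L : Type) [Field L] [NumberField L] [IsCMField L] (ι : L →+* ℂ) (H : Matrix (Fin 3) (Fin 3) L) (T : GL (Fin 3) ℂ)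
  (hT : (T : Matrix (Fin 3) (Fin 3) ℂ)ᴴ * H.map ι * (T : Matrix (Fin 3) (Fin 3) ℂ) = Literature.Geometry.ComplexHyperbolic.BallModel.J)
  (μA : Measure (adelicGroupData (↥(maximalRealSubfield L)) L (IsCMField.complexConj L) 3 H).automorphicQuotient)
  [(adelicGroupData (↥(maximalRealSubfield L)) L (IsCMField.complexConj L) 3 H).IsAutomorphicMeasure μA]
  (μv : ∀ v : HeightOneSpectrum (𝓞 ↥(maximalRealSubfield L)), @Measure ((cmDatum L 3 H).Local v) (borel _))
  (Ξ : OneDimAutRepH L → PacketPrimeFin L H) {H' : Matrix (Fin 3) (Fin 3) L}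
  (𝔩 : ∀ v : HeightOneSpectrum (𝓞 ↥(maximalRealSubfield L)), LocalPacketKit L H' v)
  (X : DatumInputs TG' TG TH L ι H T hT μA Ξ 𝔩)

/-- **(→) a packet `ρ` lifts to carries `ρ`'s grade**: if `Π(ρ)` is UNIQUE (`hfun`), then `liftsTo ρ P → gradePacketH l ρ = gradePacket l P` — the chosen `Π(ρ)` of ★ `gradePacketH`
IS `P`. [cite: Rogawski1990, §13.3 Thm. 13.3.2 p. 201; §14.6 p. 242] -/
theorem gradePacketH_eq_of_liftsTo
    (hfun : ∀ (ρ : X.G.PacketH) (P Q : X.G.Packet), X.G.liftsTo ρ P → X.G.liftsTo ρ Q → P = Q)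
    (l : Level L) (ρ : X.G.PacketH) (P : X.G.Packet) (h : X.G.liftsTo ρ P) :
    gradePacketH TG' TG TH L ι H T hT μA μv Ξ 𝔩 X l ρ = gradePacket TG' TG TH L ι H T hT μA μv Ξ 𝔩 X l P := by
  have hex : ∃ Q : X.G.Packet, X.G.liftsTo ρ Q := ⟨P, h⟩
  rw [gradePacketH_of_exists TG' TG TH L ι H T hT μA μv Ξ 𝔩 X l ρ hex, hfun ρ _ _ (Classical.choose_spec hex) h]

/-- **(←) a packet graded like `Π(ρ)` IS `Π(ρ)`**: if the grade at `l` determines the packet (`htP`, Thm. 13.3.5 rigidity at the level), then `gradePacket l P = some e` and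
`gradePacketH l ρ = some e` give `liftsTo ρ P` («`ψ_G` is injective on e.v.p.'s»). [cite: Rogawski1990, §13.3 Thm. 13.3.5 p. 202; §13.7 p. 206] -/
theorem liftsTo_of_gradePacketH_eq_some
    (htP : ∀ (l : Level L) (P Q : X.G.Packet) (e : Evp L H),
      gradePacket TG' TG TH L ι H T hT μA μv Ξ 𝔩 X l P = some e → gradePacket TG' TG TH L ι H T hT μA μv Ξ 𝔩 X l Q = some e → P = Q)
    (l : Level L) (ρ : X.G.PacketH) (P : X.G.Packet) (e : Evp L H)
    (hP : gradePacket TG' TG TH L ι H T hT μA μv Ξ 𝔩 X l P = some e) (hρ : gradePacketH TG' TG TH L ι H T hT μA μv Ξ 𝔩 X l ρ = some e) :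
    X.G.liftsTo ρ P := by
  by_cases hex : ∃ Q : X.G.Packet, X.G.liftsTo ρ Q
  · rw [gradePacketH_of_exists TG' TG TH L ι H T hT μA μv Ξ 𝔩 X l ρ hex] at hρ
    rw [← htP l _ _ e hρ hP]
    exact Classical.choose_spec hex
  · rw [gradePacketH_of_not_exists TG' TG TH L ι H T hT μA μv Ξ 𝔩 X l ρ hex] at hρ
    exact absurd hρ (by simp)

/-- **`hliftE` — THE (MN-cm) BINDER FROM THE TWO LAWS** (★ `R90S9HmnAtLevelDatum` ∕ ★ (δ6c) `definiteAeRigidity_payLine` :281–:283 VERBATIM at generic `X`, `Ξ`): for a packet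
`P` graded `e` at the level `l`, `ρ` lifts to `P` iff `ρ`'s grade at `l` is `e` — from «`liftsTo` is functional» (`hfun`; at `gOfRecord`: ★-grade S5-C2 `R90.S5.LiftsToOfRecord.packet_eq`)
and the level rigidity `htP` (B row 29 `sock_S9_tP_cm`). [cite: Rogawski1990, §13.3 Thm. 13.3.2 p. 201, Thm. 13.3.5 p. 202; §13.7 p. 206; §14.6 p. 242] -/
theorem hliftE_of_functional_of_tP
    (hfun : ∀ (ρ : X.G.PacketH) (P Q : X.G.Packet), X.G.liftsTo ρ P → X.G.liftsTo ρ Q → P = Q)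
    (htP : ∀ (l : Level L) (P Q : X.G.Packet) (e : Evp L H),
      gradePacket TG' TG TH L ι H T hT μA μv Ξ 𝔩 X l P = some e → gradePacket TG' TG TH L ι H T hT μA μv Ξ 𝔩 X l Q = some e → P = Q)
    (l : Level L) (ρ : X.G.PacketH) (P : X.G.Packet) (e : Evp L H)
    (hP : gradePacket TG' TG TH L ι H T hT μA μv Ξ 𝔩 X l P = some e) :
    X.G.liftsTo ρ P ↔ gradePacketH TG' TG TH L ι H T hT μA μv Ξ 𝔩 X l ρ = some e :=
  ⟨fun h => (gradePacketH_eq_of_liftsTo TG' TG TH L ι H T hT μA μv Ξ 𝔩 X hfun l ρ P h).trans hP,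
    liftsTo_of_gradePacketH_eq_some TG' TG TH L ι H T hT μA μv Ξ 𝔩 X htP l ρ P e hP⟩

end LiftGrade

end Summit.HodgeConjecture.HodgeConjecture.R90.S9.InnerFormSec146

end
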